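import Mathlib
import HarnessLib
import HarnessLib.Audit
import Summits.RiemannHypothesis.Statement
import Summits.RiemannHypothesis.RiemannHypothesis.Theorems.IntegerScrewDefs
import HarnessLib.Audit.Status.Attr

/-!
Route: ScrewInnovationDivisorLaw

# Route ScrewInnovationDivisorLaw — The screw innovation divisor law - the optimal predictor of
x(log M) from the earlier screw-line points loads with one sign on the largest proper divisor of M,
uniformly in M

RUNG ROUTE (D-0061; D-0145 line L12 «H_M ARITHMETIC PATTERN», registrar seat rh-idea-6, KEY =
SPECTRAL / TRACE METHODS, DBR column B-D(a) → B-P(P1)/(P2); own RH-FREE target, born DRAFT: `closes`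
concludes the route's target `DivisorLaw`, not the Statement, and no registered alternative closer
exists yet). The rh-dbr cell fixed the finite Hamiltonian as «H_M := innovation data of the nested
chain S_2 ⊂ S_3 ⊂ … of screw Gram matrices» (DATA.md §EM-1; S_M = [G(log a, log a')]_{2≤a,a'≤M},
G(t,u) = Ψ(t)+Ψ(u)−Ψ(t−u), Ψ = Suzuki's screw function, closed form arXiv:2206.03682 (1.1) = tree
`zetaScrew`; S_M = `screwMatrix (M−1)` of the S-P column) and measured, in two certified lineages
for M ≤ 128, that the optimal one-step linear predictor c_M := S_{M−1}⁻¹ b_M of x(log M) from x(log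
2), …, x(log(M−1)) (b_M(a) = G(log a, log M) = `screwBorder`) carries an ARITHMETIC SIGN PATTERN:
its coefficient on the largest proper divisor M/p_min(M) has one fixed sign for EVERY composite 6 ≤
M ≤ 128 (negative in the predictor convention c = S⁻¹b used here, i.e. the innovation row Λ_M =
(−c_M, 1) of S_M = LDLᵀ loads positively on M/p_min; the only exception below 6 is M = 4), while
primes M show no divisor structure (DATA.md (T-c), «candidate RH-FREE finite targets (B-P(P1)-type);
whether an M-uniform statement holds is open»). This seat re-derived the tables in an independent
float lineage (HOME/L12/law_check.py: 0 violations for 6 ≤ M ≤ 128, 326/389 divisor pairs negative =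
the cell's 326/390) and extended them past the certified range (every composite 129 ≤ M ≤ 169 and
177 ≤ M ≤ 196, and the samples M = 2p = 226, 254, 262, 274, 298, 302, 326, 346: 0 violations; M =
2·prime is the weakest case: c = −0.215, −0.118, −0.101, −0.096 at M = 22, 134, 254, 326). X = THE
DIVISOR LAW, M-uniform: for every composite M ≥ 6 with S_{M−1} ≻ 0, (S_{M−1}⁻¹ b_M)(M/p_min(M)) < 0.
It is typed over the tree's `screwMatrix`/`screwBorder` (row i ↔ node a = i+2) with `Matrix.PosDef`
as the standing hypothesis (RH-free: certified for M ≤ 128; under RH for all M). The line files X as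
the target with the two regimes as its obligations: K1 = the certified range 6 ≤ M ≤ 128 (a finite
statement decidable by interval arithmetic on (1.1) and exact rational elimination — the instrument
exists: the S-P column's M ≤ 128 kernel certificates and the rh-dbr EM engines), K2 = the tail M >
128 (OPEN; no mechanism is known: the seat's split of c_M(M/p) into the contributions of the
archimedean part of b_M and of each prime-power ramp Λ(k)k^{−1/2}(log(M/(ka)))₊ shows pieces of size
10–80 cancelling to ±0.2, so the sign is NOT a local kink-at-a-divisor-node effect of S⁻¹). No
summit is proved by this line; the law neither follows from nor implies RH; nothing here bears on
the truth of RH.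
Lean: `∀ M : ℕ, 6 ≤ M → ¬ Nat.Prime M →
(Summit.RiemannHypothesis.RiemannHypothesis.Theorems.IntegerScrew.screwMatrix (M - 2)).PosDef → ∀ i
: Fin (M - 2), ((i : ℕ) + 2) * Nat.minFac M = M →
((Summit.RiemannHypothesis.RiemannHypothesis.Theorems.IntegerScrew.screwMatrix (M - 2))⁻¹.mulVec
(fun j => Summit.RiemannHypothesis.RiemannHypothesis.Theorems.IntegerScrew.screwBorder (M - 2) j 0))
i < 0`

Rationale: WHY THIS LINE. LADDER-RH B-P asks for «(P1) RH-free identities for H_M per M … (P2) an M-uniform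
arithmetic description of H_M [would be the route]», typable only after B-D(a); the rh-dbr cell
executed B-D(a) (EM-1/2/3, DATA.md ll. 700–1050: H_M := innovation data; verdict on a de
Branges/minimum-phase reading ET4(b) KILLED — D_16…D_128 have zeros in both half-planes — and on
«arithmetic pattern in H_M/E_M» NO/UNDECIDED under its pre-registered test Q4 ∧ Q5b) and named
exactly one surviving arithmetic regularity, the divisor law of the predictor rows (T-c), as the
candidate finite target. As L12 registrar this seat types that law M-uniformly over the S-P column's
existing objects (`screwMatrix`, `screwBorder`, the predictor φ = S⁻¹b of
`IntegerScrewPivotUpperBound` §«form filter», the innovation identities of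
`ScrewChristoffelInnovation`), reproduces and extends the data, and files the finite range and the
tail as the two obligations, so that the DBR column has a typed, killable P2 object with a certified
P1 rung under it. Imported: Cholesky/innovation geometry of nested Gram matrices (Kreĭn strings in
finite form), certified numerics; the explicit formula enters only through the closed form of Ψ.
Sources: arXiv:2206.03682 ((1.1), Thm 1.4), arXiv:2209.04658 (the screw line x(log n)), tree
Theorems/IntegerScrewDefs.lean, Theorems/IntegerScrewPivotUpperBound.lean,
Theorems/ScrewChristoffelInnovation.lean, pub/rh-dbr/DATA.md §EM-1 (T-c), (Z4).

RANKED CRUXES. #0 DivisorLaw (target) — THE DIVISOR LAW (M-uniform): for every composite M ≥ 6 with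
S_{M−1} = screwMatrix (M−2) positive definite and every row index i with (i+2)·minFac M = M (the
node a = i+2 = M/p_min(M), the largest proper divisor), the predictor coefficient ((screwMatrix
(M−2))⁻¹ · screwBorder (M−2))ᵢ is negative. [deps: DivisorLawCertifiedRange, DivisorLawTail]
[difficulty: XL] (why it might fail: it is a data law (M ≤ 196, samples to 346); the weakest cases M
= 2p drift toward 0 (−0.215, −0.118, −0.096 at M = 22, 134, 326) and may cross at some larger 2p,
exactly as Gram's and Pólya's empirical sign laws failed late.) [arXiv:2206.03682, arXiv:2209.04658,
tree:Summits/RiemannHypothesis/RiemannHypothesis/Theorems/IntegerScrewDefs.lean,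
tree:Summits/RiemannHypothesis/RiemannHypothesis/Theorems/ScrewChristoffelInnovation.lean]
#2 DivisorLawTail (crux) — (K2, the open regime) the divisor law for every composite M > 128 with
screwMatrix (M−2) positive definite: the predictor coefficient at the node M/minFac M is negative.
[difficulty: XL] (why it might fail: no mechanism: the coefficient is a cancellation of
O(10–80)-sized contributions (archimedean part vs prime ramps of b_M), so nothing protects the sign
as M → ∞; M = 2p cases weaken (−0.118 at M = 134, −0.096 at 326); PosDef itself is RH-strength
beyond the certified range.) [arXiv:2206.03682,
tree:Summits/RiemannHypothesis/RiemannHypothesis/Theorems/IntegerScrewPivotUpperBound.lean,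
tree:Literature/Barriers/RiemannHypothesis/GramRosserFailures.lean]
#3 DivisorLawCertifiedRange (crux) — (K1, the certified range = the P1 rung) the divisor law for
every composite 6 ≤ M ≤ 128 with screwMatrix (M−2) positive definite — a finite statement, decidable
by interval arithmetic on the closed form (1.1) of Ψ and exact elimination; measured true in two
certified lineages (rh-dbr EM-1 A/B, agreement 1e−95) and one float lineage (this seat).
[difficulty: L] (why it might fail: the smallest margin is M = 6 (c(3) = −0.0053, five times smaller
than any other case); a kernel certificate needs Ψ to ~1e−4 relative through a 4×4 solve there and
~1e−6 through 126×126 solves (condition numbers ~1e5) — feasible but not yet run in Lean.)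
[arXiv:2206.03682, tree:Summits/RiemannHypothesis/RiemannHypothesis/Theorems/IntegerScrewDefs.lean,
tree:Literature/NumberTheory/LFunctions/ZetaScrew.lean]

TWO-LAYER PLAN. Foreseen glued splits (not filed now): DivisorLawCertifiedRange ⇐
(CertifiedPsiBoxes: interval enclosures of Ψ(log(a/a')) for 2 ≤ a' < a ≤ 128 from (1.1) with the
Lerch tail bounded) → (CertifiedElimination: sign of (S⁻¹b)(M/p) by exact rational LDLᵀ on the box
midpoints plus a perturbation bound ‖S⁻¹‖·width) → K1; DivisorLawTail ⇐ (LocalUniversality: as M → ∞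
the predictor restricted to nodes a ≥ M/2 converges, after the rescaling log a = log M − h, to the
predictor of the stationary-increment process with structure function 2Ψ(h) on the grid h = −log(1 −
k/M) — this controls the NEAREST-NODE companion law, coefficient on M−1 positive for 19 ≤ M ≤ 196) →
(DivisorKink: the Euler-product kinks of Ψ at h = log p sit exactly on the node a = M/p iff p | M; a
transfer estimate bounding the non-divisor and archimedean contributions) → K2. The second chain is
a research programme, not a lemma list; it is recorded so the first prover does not start there.

KILL CRITERIA. One composite M with screwMatrix (M−2) ≻ 0 (certified) and (S_{M−1}⁻¹ b_M)(M/p_min) ≥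
0 (certified sign) refutes DivisorLaw and DivisorLawTail (if M > 128) or DivisorLawCertifiedRange
(if M ≤ 128) and closes the route `refuted:<item>`; the refuting instrument row is the rh-dbr EM
engine (HOME/DATA/code/em5/lineageA.py, certified LDLᵀ of S_M) or the S-P column's M ≤ 128 kernel,
extended in M. A certified failure of PosDef at some M would not refute the law (vacuous there) but
would bear on RH itself through the S-P column's `ScrewDeterminantChain` — that is NOT claimed or
expected here.

NOT DECOMPOSED YET. Everything under K2: no asymptotic theory of S_M⁻¹ exists in the tree or in
print (the S-P column controls pivots d_M = diagonal of D — `screwPivot`, floors/ceilings G(M)·log M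
— not the rows of L⁻¹); the companion NEAREST-NODE LAW (coefficient on M−1 positive for 19 ≤ M ≤
196, −/+ pattern below 19) and the 84 % law on all divisor pairs are recorded in Numbers, not filed;
the certified-range crux is one item although its proof will be ~120 per-M certificates (provers
attach them `--supports`).

CHEAPEST FALSIFIER. Extend the table to 141 ≤ M ≤ 512 (one kit job, the cell's lineage-A code at 60
digits or HOME/L12/law_check.py ported to mpmath; minutes per M at M ~ 500): the first composite M
with a non-negative coefficient at M/p_min kills K2 and the target. Watch M = 2p first (weakest:
−0.096 at M = 326). This seat's float runs (every composite M ≤ 169 and 177–196; M = 2p sampled to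
346) found none (HOME/L12/law_check.out, sweep1-3.out, twop.out).

NUMBERS. Predictor convention c_M = S_{M−1}⁻¹ b_M (the cell's tables list the innovation row −c_M,
opposite sign). Certified anchors (rh-dbr (Z4), reproduced here to 6 digits): Ψ(log 2) = 0.063556,
d_2 = 2Ψ(log 2) = 0.12711, d_3 = 0.07080; Ψ(0.3), Ψ(1), Ψ(2.5) = 0.047366, 0.044007, 0.048435.
Divisor coefficient c_M(M/p_min): M = 6: −0.0053; 8: −0.209; 9: −0.308; 12: −0.221; 16: −0.328; 25:
−0.430; 32: −0.350; 64: −0.280; 96: −0.285; 128: −0.224; 129: −0.184; 130: −0.175; 134: −0.118; 135: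
−0.317; 140: −0.228; 144: −0.234; 168: −0.229; 169: −0.287; 195: −0.212; 196: −0.173; M = 2p: 146:
−0.126, 166: −0.141, 194: −0.110, 226: −0.121, 254: −0.101, 302: −0.097, 326: −0.096, 346: −0.103;
exception below the range: M = 4: +0.050. Divisor pairs (M, d), 6 ≤ M ≤ 128 composite: 326/389
negative; 129–140: 43/50 (the positive ones are always small divisors d ≤ 7). Nearest node c_M(M−1):
+0.466 (M = 4), +0.240 (6), changes sign through 8–18 (−0.015, +0.055, +0.041, −0.013, +0.006,
−0.015, −0.003, +0.003, +0.027, +0.001, −0.024), then positive for every 19 ≤ M ≤ 196 computed,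
growing: +0.010 (19), +0.079 (32), +0.219 (64), +0.279 (96), +0.373 (128), +0.405 (196), +0.553
(346). Split of c_M(M/p) = [p-ramp] + [other divisor ramps] + [non-divisor ramps] + [archimedean]: M
= 38: −21.23 + 0 − 57.00 + 78.06 = −0.18; M = 40: +2.76 + 1.99 − 0.50 − 4.57 = −0.32 (no term
dominates; HOME/L12/divisor_split.out).

DEFINITION REQUESTS. None needed (the predictor is spelled `(screwMatrix (M-2))⁻¹.mulVec (fun j =>
screwBorder (M-2) j 0)` over existing decls); a convenience `def screwPredictor (n : ℕ) : Fin n → ℝ`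
in Theorems/IntegerScrewDefs-style (topic Summits/RiemannHypothesis/RiemannHypothesis/Theorems)
would shorten every item and the certificates.

Novelty: Searches (2026-08-27, corpus fts+vec and galaxy): `lit search --hybrid "screw function of the
Riemann zeta function Gram matrix nested determinants linear predictor"` (8 docs, all off-topic
books: Loehr linear algebra, Ball's theory of screws …); `lit vsearch "sign pattern of the optimal
linear predictor coefficients … Cholesky innovation rows of a positive definite kernel matrix"` (8
docs, generic filtering/simulation texts, none on arithmetic node sets); `lit search "Suzuki screw
function Riemann hypothesis" --source all` → HELD [corpus:paper:arxiv-2206.03682] (grep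
Gram|determinant|predict|divisor: only the Gram–Schmidt of Fourier modes on (−a,a), p.12–13),
[corpus:paper:arxiv-2209.04658] (the screw line; grep: 0 hits), [corpus:paper:arxiv-2209.12832],
[corpus:paper:arxiv-2606.09096] (2026, Weil's form via the screw function; grep: a zeta-regularised
determinant of v̂_a only); `lit galaxy search "screw function|screw line|Suzuki screw" --star all` →
no mathematical hits (8 noise rows) — no hits for the integer-node Gram chain or its predictor rows
in corpus(fts+vec) and galaxy; tree: `rg lowerInv|predictor|divisor` over Theses/ and Theorems/ →
only `ScrewChristoffelInnovation.lean` (innovation identities, no sign law) and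
`IntegerScrewPivotUpperBound.lean` (the predictor as the pivot's minimiser, no sign law); `ledger
negatives --problem RiemannHypothesis`: 4 entries, disjoint vocabulary.
Nearest prior art found: the rh-dbr cell's own data note DATA.md §EM-1 (T-c)/(Q6) (no  [refs: paper:arxiv-2206.03682, paper:arxiv-2209.04658, paper:arxiv-2209.12832, paper:arxiv-2606.09096]

Barriers (technique_class: certified-linear-algebra, gram-chain-innovation, data-law): - technique_class: certified-linear-algebra, gram-chain-innovation, data-law
- Literature.Barriers.RiemannHypothesis.GramRosserFailures (with LiouvilleSignConjectures,
MertensDisproof): INSIDE their moral class for K2/target — an empirical sign law extrapolated in the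
parameter (Gram's law, Pólya's and Turán's sign conjectures, Mertens) is exactly what failed late
(Lehman 1956, Haselgrove 1958, M = 906 150 257, Odlyzko–te Riele); the line does not evade this: the
bet is that the divisor sign is structural (Euler-product kinks of Ψ at log p landing on the node
M/p iff p | M) and the falsifier is cheap (M ≤ 512 in one job); K1 is OUTSIDE (a finite certified
range is a theorem or not, no extrapolation).
- Literature.Barriers.RiemannHypothesis.TuranPartialSums (Montgomery 1983 / Platt–Trudgian 2016:
finite sections ζ_N misbehave for large N): outside its technique class — no Dirichlet partial sums
or zeros of sections occur; the sections here are Gram matrices of an RH-free positive kernel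
restricted to integer nodes, and nothing is inferred about ζ from them [corpus: tree
Literature/Barriers/RiemannHypothesis/TuranPartialSums.lean `TuranPartialSums.not_hypothesis`].
- Literature.Barriers.RiemannHypothesis.DeBrangesPositivity (Conrey–Li 2000): outside — no de
Branges space, no positivity of ζ's structure function is asserted; consistent with the rh-dbr kill
ET4(b) (finite sections D_M are not Hermite–Biehler), which this line respects by claiming nothing
about zeros of E_M/D_M.
-

sub-problem: RiemannHypothesis · status: draft · opened planner-rh-idea-6-g0-0 2026-08-27T22:31:14Z · rev 0 · ledger route-RiemannHypothesis-ScrewInnovationDivisorLaw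
GENERATED by the gate from the ledger (D-0016/17). Provers cite these decls: `theorem foo : Summit.RiemannHypothesis.RiemannHypothesis.Theses.ScrewInnovationDivisorLaw.<Decl> := …` in Summits/RiemannHypothesis/RiemannHypothesis/Theorems/<Name>.lean.
-/

namespace Summit.RiemannHypothesis.RiemannHypothesis.Theses.ScrewInnovationDivisorLaw

open scoped BigOperators Topology Manifold Classical MeasureTheory ProbabilityTheory Matrix InnerProductSpace ComplexConjugate ContinuousMap
open Filter Set Function TopologicalSpace MeasureTheory

attribute [summit_statement] _root_.Summit.RiemannHypothesis

open Summit

/-- item stmt-RiemannHypothesis-23157 · target · rank 0 · open · by planner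
why it might fail: it is a data law (M ≤ 196, samples to 346); the weakest cases M = 2p drift toward 0 (−0.215, −0.118, −0.096 at M = 22, 134, 326) and may cross at some larger 2p, exactly as Gram's and Pólya's empirical sign laws failed late.
sources: arXiv:2206.03682, arXiv:2209.04658, tree:Summits/RiemannHypothesis/RiemannHypothesis/Theorems/IntegerScrewDefs.lean, tree:Summits/RiemannHypothesis/RiemannHypothesis/Theorems/ScrewChristoffelInnovation.lean
[target] THE DIVISOR LAW (M-uniform): for every composite M ≥ 6 with S_{M−1} = screwMatrix (M−2)
positive definite and every row index i with (i+2)·minFac M = M (the node a = i+2 = M/p_min(M), the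
largest proper divisor), the predictor coefficient ((screwMatrix (M−2))⁻¹ · screwBorder (M−2))ᵢ is
negative. [deps: DivisorLawCertifiedRange, DivisorLawTail] [difficulty: XL] -/
@[route_item "route-RiemannHypothesis-ScrewInnovationDivisorLaw"]
def DivisorLaw : Prop :=
  ∀ M : ℕ, 6 ≤ M → ¬ Nat.Prime M → (Summit.RiemannHypothesis.RiemannHypothesis.Theorems.IntegerScrew.screwMatrix (M - 2)).PosDef → ∀ i : Fin (M - 2), ((i : ℕ) + 2) * Nat.minFac M = M → ((Summit.RiemannHypothesis.RiemannHypothesis.Theorems.IntegerScrew.screwMatrix (M - 2))⁻¹.mulVec (fun j => Summit.RiemannHypothesis.RiemannHypothesis.Theorems.IntegerScrew.screwBorder (M - 2) j 0)) i < 0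

/-- item stmt-RiemannHypothesis-23158 · crux · rank 2 · open · by planner
why it might fail: no mechanism: the coefficient is a cancellation of O(10–80)-sized contributions (archimedean part vs prime ramps of b_M), so nothing protects the sign as M → ∞; M = 2p cases weaken (−0.118 at M = 134, −0.096 at 326); PosDef itself is RH-strength beyond the certified range.
sources: arXiv:2206.03682, tree:Summits/RiemannHypothesis/RiemannHypothesis/Theorems/IntegerScrewPivotUpperBound.lean, tree:Literature/Barriers/RiemannHypothesis/GramRosserFailures.lean
[crux] (K2, the open regime) the divisor law for every composite M > 128 with screwMatrix (M−2)
positive definite: the predictor coefficient at the node M/minFac M is negative. [difficulty: XL] -/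
@[route_item "route-RiemannHypothesis-ScrewInnovationDivisorLaw", crux]
def DivisorLawTail : Prop :=
  ∀ M : ℕ, 128 < M → ¬ Nat.Prime M → (Summit.RiemannHypothesis.RiemannHypothesis.Theorems.IntegerScrew.screwMatrix (M - 2)).PosDef → ∀ i : Fin (M - 2), ((i : ℕ) + 2) * Nat.minFac M = M → ((Summit.RiemannHypothesis.RiemannHypothesis.Theorems.IntegerScrew.screwMatrix (M - 2))⁻¹.mulVec (fun j => Summit.RiemannHypothesis.RiemannHypothesis.Theorems.IntegerScrew.screwBorder (M - 2) j 0)) i < 0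

/-- item stmt-RiemannHypothesis-23159 · crux · rank 3 · open · by planner
why it might fail: the smallest margin is M = 6 (c(3) = −0.0053, five times smaller than any other case); a kernel certificate needs Ψ to ~1e−4 relative through a 4×4 solve there and ~1e−6 through 126×126 solves (condition numbers ~1e5) — feasible but not yet run in Lean.
sources: arXiv:2206.03682, tree:Summits/RiemannHypothesis/RiemannHypothesis/Theorems/IntegerScrewDefs.lean, tree:Literature/NumberTheory/LFunctions/ZetaScrew.lean
[crux] (K1, the certified range = the P1 rung) the divisor law for every composite 6 ≤ M ≤ 128 with
screwMatrix (M−2) positive definite — a finite statement, decidable by interval arithmetic on the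
closed form (1.1) of Ψ and exact elimination; measured true in two certified lineages (rh-dbr EM-1
A/B, agreement 1e−95) and one float lineage (this seat). [difficulty: L] -/
@[route_item "route-RiemannHypothesis-ScrewInnovationDivisorLaw", crux]
def DivisorLawCertifiedRange : Prop :=
  ∀ M : ℕ, 6 ≤ M → M ≤ 128 → ¬ Nat.Prime M → (Summit.RiemannHypothesis.RiemannHypothesis.Theorems.IntegerScrew.screwMatrix (M - 2)).PosDef → ∀ i : Fin (M - 2), ((i : ℕ) + 2) * Nat.minFac M = M → ((Summit.RiemannHypothesis.RiemannHypothesis.Theorems.IntegerScrew.screwMatrix (M - 2))⁻¹.mulVec (fun j => Summit.RiemannHypothesis.RiemannHypothesis.Theorems.IntegerScrew.screwBorder (M - 2) j 0)) i < 0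

/-- item stmt-RiemannHypothesis-23160 · assembly · rank 1 · closed · proved by Summit.RiemannHypothesis.RiemannHypothesis.Theorems.ScrewInnovationDivisorLaw.assembly_proof (prover) · by planner
sources: tree:Summits/RiemannHypothesis/RiemannHypothesis/Theorems/IntegerScrewDefs.lean, arXiv:2206.03682
[assembly] the two regimes give the law (case split on M ≤ 128); PROVABLE NOW — kernel-checked as
`divisorLaw_of` in HOME/line4/Sketch.lean (farm rc 0, 0 sorries): `intro M h6 hnp hS i hi; by_cases
hM : M ≤ 128; exact h1 …; exact h2 M (by omega) …`. -/
@[route_item "route-RiemannHypothesis-ScrewInnovationDivisorLaw", crux]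
def Assembly : Prop :=
  DivisorLawCertifiedRange → DivisorLawTail → DivisorLaw

-- `Assembly` holds: proved by `Summit.RiemannHypothesis.RiemannHypothesis.Theorems.ScrewInnovationDivisorLaw.assembly_proof` (its module imports this route file, so no `_holds` link can be stated here).

/-! D-0027 §2.1 — DECIDING THEOREM (planner-authored via `route open/edit --closes-file`; by planner-rh-idea-6-g0-0 2026-08-27T22:31:23Z):
its hypotheses are this route's items and its conclusion the sub-problem Statement (glue_lint), and it elaborates with this file. -/

@[closes "route-RiemannHypothesis-ScrewInnovationDivisorLaw"] theorem closes (h1 : DivisorLawCertifiedRange) (h2 : DivisorLawTail) (hA : Assembly) :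
    DivisorLaw :=
  hA h1 h2

end Summit.RiemannHypothesis.RiemannHypothesis.Theses.ScrewInnovationDivisorLaw
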